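import Literature.AlgebraicGeometry.Resolution.OriginLocalRing
import Literature.AlgebraicGeometry.Resolution.QuadraticTransforms
import HarnessLib

/-!
# Quadratic transforms of `F[x,y]_{(x,y)}` at rational points of the exceptional line

Topic: `Literature/AlgebraicGeometry/Resolution`. For an algebraically independent pair `(P, Q)`
in an `F`-field `L` and `γ ∈ F`, the ring `F[Q, P/Q − γ]_{(Q, P/Q − γ)}` — the local ring of
the blowing up of the origin of `Spec F[P,Q]_{(P,Q)}` at the rational point `P/Q = γ` of the
exceptional line (chart `Q ≠ 0`) — contains `F[P,Q]_{(P,Q)}`, dominates it, and IS a quadratic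
transform of it in the sense of Cutkosky §2.1 (`IsQuadraticTransform`, `QuadraticTransforms.lean`).
These are exactly the steps `B_i → B_{i+1}` (`x = x₁y₁`, …, `x = x_pᵖ(y_p + α), y = x_p`) and
`A_i → A_{i+1}` of Cutkosky's towers (Math. Ann. 362 (2015), §3); infrastructure for the
discharge of `Literature.Barriers.ResolutionOfSingularities.Cutkosky.Cutkosky2014`.
All [folklore].

## Content (all proved)

* `originCoord_mem_maximalIdeal`, `originLocalRing_eq_of_forall_mem` (two coordinate systems
  each lying in the other's maximal ideal give the same local ring; e.g. swapping coordinates);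
* `aeval_mem_blowupRing` (polynomials in `Q, P/Q − γ` lie in `R[𝔪_R/Q]`);
* `originLocalRing_le_blowupPoint`, `inv_mem_of_blowupPoint` (inclusion with domination) and
  `isQuadraticTransform_blowupPoint`: `F[Q, P/Q − γ]_{(…)}` is a quadratic transform of
  `F[P,Q]_{(P,Q)}`.
-/

noncomputable section

namespace Literature.AlgebraicGeometry.Resolution

universe u v

open _root_.MvPolynomial IsLocalRing

variable {F : Type u} [Field F] {L : Type v} [Field L] [Algebra F L]

/-! ## Coordinates and the maximal ideal -/

/-- The coordinates lie in the maximal ideal of `F[x]_{(x)}`. [folklore] -/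
theorem originCoord_mem_maximalIdeal {n : ℕ} {x : Fin n → L} (hx : AlgebraicIndependent F x)
    (i : Fin n) : haveI := isLocalRing_originLocalRing hx;
      originCoord hx i ∈ maximalIdeal (originLocalRing hx) := by
  rw [maximalIdeal_originLocalRing]
  exact Ideal.subset_span ⟨i, rfl⟩

/-- Two algebraically independent families, each lying in the maximal ideal of the other's local
ring, have the same local ring (e.g. a permutation of the coordinates). [folklore] -/
theorem originLocalRing_eq_of_forall_mem {n m : ℕ} {x : Fin n → L} {y : Fin m → L}
    (hx : AlgebraicIndependent F x) (hy : AlgebraicIndependent F y)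
    (hxy : ∀ i, x i ∈ originLocalRing hy)
    (hxmax : ∀ i, haveI := isLocalRing_originLocalRing hy;
      (⟨x i, hxy i⟩ : originLocalRing hy) ∈ maximalIdeal (originLocalRing hy))
    (hyx : ∀ j, y j ∈ originLocalRing hx)
    (hymax : ∀ j, haveI := isLocalRing_originLocalRing hx;
      (⟨y j, hyx j⟩ : originLocalRing hx) ∈ maximalIdeal (originLocalRing hx)) :
    originLocalRing hx = originLocalRing hy :=
  le_antisymm (originLocalRing_le_of_forall_mem_maximalIdeal hx hy hxy hxmax)
    (originLocalRing_le_of_forall_mem_maximalIdeal hy hx hyx hymax)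

/-- A scalar lies in `F[x]_{(x)}`. [folklore] -/
theorem algebraMap_mem_originLocalRing {n : ℕ} {x : Fin n → L} (hx : AlgebraicIndependent F x)
    (c : F) : algebraMap F L c ∈ originLocalRing hx :=
  Subalgebra.algebraMap_mem _ c

/-! ## The blown-up point `F[Q, P/Q − γ]_{(Q, P/Q − γ)}` -/

section BlowupPoint

variable {P Q : L} (hPQ : AlgebraicIndependent F ![P, Q]) (γ : F)
  (h' : AlgebraicIndependent F ![Q, P / Q - algebraMap F L γ])

include hPQ in
/-- `Q ≠ 0`. [folklore] -/
theorem blowupPoint_Q_ne_zero : Q ≠ 0 := by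
  simpa using hPQ.ne_zero 1

/-- `P = Q · ((P/Q − γ) + γ)` as a polynomial identity in the new coordinates. [folklore] -/
theorem blowupPoint_P_eq (hQ : Q ≠ 0) :
    P = aeval ![Q, P / Q - algebraMap F L γ] (X 0 * (X 1 + C γ) : MvPolynomial (Fin 2) F) := by
  simp only [map_mul, map_add, aeval_X, aeval_C, Matrix.cons_val_zero, Matrix.cons_val_one]
  rw [sub_add_cancel, mul_div_cancel₀ _ hQ]

include hPQ in
/-- `P, Q ∈ F[Q, P/Q − γ]_{(…)}`. [folklore] -/
theorem blowupPoint_mem : ∀ i, ![P, Q] i ∈ originLocalRing h' := by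
  refine Fin.forall_fin_two.mpr ⟨?_, ?_⟩
  · have hm := aeval_mem_originLocalRing h' (X 0 * (X 1 + C γ) : MvPolynomial (Fin 2) F)
    rw [← blowupPoint_P_eq (P := P) γ (blowupPoint_Q_ne_zero hPQ)] at hm
    exact hm
  · simpa using mem_originLocalRing_self h' 0

include hPQ in
/-- `P, Q` lie in the maximal ideal of `F[Q, P/Q − γ]_{(…)}`. [folklore] -/
theorem blowupPoint_mem_maximalIdeal : ∀ i, haveI := isLocalRing_originLocalRing h';
    (⟨![P, Q] i, blowupPoint_mem hPQ γ h' i⟩ : originLocalRing h') ∈ maximalIdeal (originLocalRing h') := by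
  haveI := isLocalRing_originLocalRing h'
  have hQ : (⟨Q, by simpa using mem_originLocalRing_self h' 0⟩ : originLocalRing h') ∈
      maximalIdeal (originLocalRing h') := by
    have := originCoord_mem_maximalIdeal h' 0
    exact this
  refine Fin.forall_fin_two.mpr ⟨?_, hQ⟩
  -- `P = Q · (W + γ)` with `Q ∈ 𝔪`
  have hW : P / Q - algebraMap F L γ + algebraMap F L γ ∈ originLocalRing h' :=
    add_mem (by simpa using mem_originLocalRing_self h' 1) (algebraMap_mem_originLocalRing h' γ)
  have e : (⟨![P, Q] 0, blowupPoint_mem hPQ γ h' 0⟩ : originLocalRing h') =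
      ⟨Q, by simpa using mem_originLocalRing_self h' 0⟩ * ⟨_, hW⟩ := by
    apply Subtype.ext
    change P = Q * (P / Q - algebraMap F L γ + algebraMap F L γ)
    rw [sub_add_cancel, mul_div_cancel₀ _ (blowupPoint_Q_ne_zero hPQ)]
  rw [e]
  exact Ideal.mul_mem_right _ _ hQ

include hPQ in
/-- **`F[P,Q]_{(P,Q)} ⊆ F[Q, P/Q − γ]_{(Q, P/Q − γ)}`.** [folklore] -/
theorem originLocalRing_le_blowupPoint : originLocalRing hPQ ≤ originLocalRing h' :=
  originLocalRing_le_of_forall_mem_maximalIdeal hPQ h' (blowupPoint_mem hPQ γ h')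
    (blowupPoint_mem_maximalIdeal hPQ γ h')

include hPQ in
/-- **`F[Q, P/Q − γ]_{(…)}` dominates `F[P,Q]_{(P,Q)}`.** [folklore] -/
theorem subringDominates_blowupPoint :
    SubringDominates (originLocalRing hPQ).toSubring (originLocalRing h').toSubring :=
  ⟨originLocalRing_le_blowupPoint hPQ γ h', fun _ hq hinv =>
    inv_mem_originLocalRing_of_forall_mem_maximalIdeal hPQ h' (blowupPoint_mem hPQ γ h')
      (blowupPoint_mem_maximalIdeal hPQ γ h') hq hinv⟩

/-- Polynomials (over `F`) in elements of a subring containing `F[P,Q]_{(P,Q)}` lie in that subring.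
[folklore] -/
theorem aeval_mem_subring_of_le {n m : ℕ} {x : Fin n → L} (hx : AlgebraicIndependent F x)
    {S : Subring L} (hS : (originLocalRing hx).toSubring ≤ S) {z : Fin m → L} (hz : ∀ i, z i ∈ S)
    (f : MvPolynomial (Fin m) F) : aeval z f ∈ S := by
  induction f using MvPolynomial.induction_on with
  | C a =>
    rw [aeval_C]
    exact hS (algebraMap_mem_originLocalRing hx a)
  | add f g hf hg => rw [map_add]; exact S.add_mem hf hg
  | mul_X f i hf => rw [map_mul, aeval_X]; exact S.mul_mem hf (hz i)

include hPQ in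
/-- `Q/Q = 1` and `P/Q` lie in the blow-up ring `R[𝔪_R/Q]`, `R = F[P,Q]_{(P,Q)}`; hence so do all
polynomials in `Q` and `P/Q − γ`. [folklore] -/
theorem aeval_blowupPointCoord_mem_blowupRing (f : MvPolynomial (Fin 2) F) :
    haveI := isLocalRing_originLocalRing hPQ;
    aeval ![Q, P / Q - algebraMap F L γ] f ∈ blowupRing (originLocalRing hPQ).toSubring Q := by
  haveI := isLocalRing_originLocalRing hPQ
  refine aeval_mem_subring_of_le hPQ (le_blowupRing _ Q) (Fin.forall_fin_two.mpr ⟨?_, ?_⟩) f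
  · exact le_blowupRing _ Q (by simpa using mem_originLocalRing_self hPQ 1)
  · refine Subring.sub_mem _ ?_ (le_blowupRing _ Q (algebraMap_mem_originLocalRing hPQ γ))
    have hP : (originCoord hPQ 0 : originLocalRing hPQ) ∈ maximalIdeal (originLocalRing hPQ) :=
      originCoord_mem_maximalIdeal hPQ 0
    exact div_mem_blowupRing (R := (originLocalRing hPQ).toSubring) Q (y := originCoord hPQ 0) hP

include hPQ in
/-- **`F[Q, P/Q − γ]_{(Q, P/Q − γ)}` is a quadratic transform of `F[P,Q]_{(P,Q)}`** (Cutkosky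
§2.1): it is `R[𝔪_R/Q]` localised at the prime `(Q, P/Q − γ)` lying over `𝔪_R`. [folklore] -/
theorem isQuadraticTransform_blowupPoint :
    IsQuadraticTransform (originLocalRing hPQ).toSubring (originLocalRing h').toSubring := by
  haveI := isLocalRing_originLocalRing hPQ
  haveI := isLocalRing_originLocalRing h'
  have hQ0 : Q ≠ 0 := blowupPoint_Q_ne_zero hPQ
  have hle := originLocalRing_le_blowupPoint hPQ γ h'
  have hQm : (originCoord hPQ 1 : originLocalRing hPQ) ∈ maximalIdeal (originLocalRing hPQ) :=
    originCoord_mem_maximalIdeal hPQ 1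
  refine ⟨‹_›, originCoord hPQ 1, hQm, fun e => hQ0 (congrArg Subtype.val e),
    (inferInstance : IsLocalRing (originLocalRing h')), ?_, ?_, subringDominates_blowupPoint hPQ γ h'⟩
  · -- `R[𝔪_R/Q] ⊆ B'`: generators `a/Q`, `a ∈ 𝔪_R = (P, Q)`
    refine Subring.closure_le.mpr ?_
    rintro z (hz | ⟨a, ha, rfl⟩)
    · exact hle hz
    · have ha' : (⟨(a : L), a.2⟩ : originLocalRing hPQ) ∈ Ideal.span (Set.range (originCoord hPQ)) := by
        rw [← maximalIdeal_originLocalRing hPQ]; exact ha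
      change (((⟨(a : L), a.2⟩ : originLocalRing hPQ) : L)) / Q ∈ originLocalRing h'
      refine Submodule.span_induction
        (p := fun (b : originLocalRing hPQ) (_ : b ∈ Ideal.span (Set.range (originCoord hPQ))) =>
          (b : L) / Q ∈ originLocalRing h') ?_ ?_ ?_ ?_ ha'
      · rintro _ ⟨i, rfl⟩
        fin_cases i
        · -- `P / Q = (P/Q - γ) + γ`
          change P / Q ∈ originLocalRing h'
          have hm : (P / Q - algebraMap F L γ) + algebraMap F L γ ∈ originLocalRing h' :=
            add_mem (by simpa using mem_originLocalRing_self h' 1) (algebraMap_mem_originLocalRing h' γ)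
          rwa [sub_add_cancel] at hm
        · change Q / Q ∈ originLocalRing h'
          rw [div_self hQ0]; exact Subalgebra.one_mem _
      · simp
      · intro a b _ _ ha hb
        rw [Subalgebra.coe_add, add_div]; exact add_mem ha hb
      · intro r a _ ha
        rw [smul_eq_mul, Subalgebra.coe_mul, mul_div_assoc]
        exact Subalgebra.mul_mem _ (hle r.2) ha
  · -- every element of `B'` is a fraction with entries in `R[𝔪_R/Q]` and unit denominator
    intro z hz
    obtain ⟨f, g, hg, rfl⟩ := (mem_originLocalRing_iff h').mp hz
    refine ⟨_, aeval_blowupPointCoord_mem_blowupRing hPQ γ f, _,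
      aeval_blowupPointCoord_mem_blowupRing hPQ γ g, ?_, rfl⟩
    -- the denominator is a unit of `B'`
    set z' : Fin 2 → originLocalRing h' := fun i => originCoord h' i
    obtain ⟨w, hw⟩ := isUnit_aeval_of_constantCoeff_ne_zero z' (originCoord_mem_maximalIdeal h') hg
    have hcoe : aeval ![Q, P / Q - algebraMap F L γ] g = ((aeval z' g : originLocalRing h') : L) := by
      rw [coe_aeval_subalgebra]; rfl
    rw [hcoe, ← hw, ← coe_units_inv_subalgebra]
    exact Subtype.mem _

end BlowupPoint

end Literature.AlgebraicGeometry.Resolution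

end
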